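import Mathlib.Analysis.InnerProductSpace.Calculus
import Mathlib.Analysis.Calculus.MeanValue
import Mathlib.MeasureTheory.Integral.IntervalIntegral.FundThmCalculus
import Literature.Analysis.FunctionSpaces.PotentialDynamics
import Literature.Analysis.FunctionSpaces.PotentialDynamicsEnergyProofs
import Literature.Analysis.FluidPDE.HardSphereRegularGeometry
import HarnessLib

/-!
# Discharged fact: conservation of energy along the `N`-body Hamiltonian flow on the flat torus

`Literature.Analysis.FunctionSpaces.PotentialDynamics` records as the named fact
`hamiltonianEnergy_flow_torus` that, for `0 < ε < 1/2`, the Hamiltonian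
`H_N(z) = ½ ∑_i |v_i|² + ∑_{i<j} Φ_ε(sep(x_i, x_j))` (`hamiltonianEnergy`, `sep` = minimal-image
separation `reprSym (x_i - x_j)`) is conserved along every potential flow
`Ψ : PotentialFlow (Torus.geometry d) Φ ε N` started from a good initial datum:
`H_N(Ψ_t z) = H_N(z)` for `z ∈ Ψ.good` and all `t` (Gallagher–Saint-Raymond–Texier 2013,
arXiv:1208.5753 numbering: Part I Ch. 1 §2, Newton's equations for the pair potential `Φ_ε`
(EMS (1.2.2)); Part III Ch. 10 §2, the `s`-particle Hamiltonian `E_ε` (EMS (1.2.3)) and the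
"conservation of energy properties" `|𝐇_s(t) g_s|_{ε,s,β} = |g_s|_{ε,s,β}` of the `s`-particle
flow, stated after Definition 2.3; the two-particle computation is (conservation-laws) of Part III
Ch. 8 §1). It is proved here (`hamiltonianEnergy_flow_torus_holds`) by the printed first-integral
computation `d/dt E_ε = ∑_i v_i · v̇_i + ∑_{i<k} ∇Φ_ε(x_i - x_k) · (v_i - v_k) = 0`, organised
through the *hard-sphere-regular geometries* of `Literature.Analysis.FluidPDE.HardSphereRegularGeometry`
so that one argument serves `T^d` (and would serve `ℝ^d`, whose energy fact is already discharged
in `PotentialDynamicsEnergyProofs` by a direct computation):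

* `Φ_ε` vanishes outside the closed ball of radius `|ε|`, so `∇Φ_ε = 0` beyond it
  (`ShortRangePotential.gradient_scaled_eq_zero`); `Φ_ε` is even, so `∇Φ_ε` is odd
  (`ShortRangePotential.gradient_scaled_neg`, from `gradient_neg_eq_neg_gradient_of_even` of the
  whole-space companion); hence in a geometry which is hard-sphere regular at radius `|ε|`
  (`sep(y, x) = -sep(x, y)` whenever `|sep(x, y)| ≤ |ε|`) the pair forces are antisymmetric,
  `∇Φ_ε(sep(x_j, x_i)) = -∇Φ_ε(sep(x_i, x_j))` (`gradient_scaled_sepVec_comm`);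
* along a Hamiltonian trajectory, `x_i(t) = x_i(t₀) + ∫_{t₀}^t v_i`
  (`IsHamiltonianTrajectory.pos_eq_translate`), and the pair potential `Φ_ε(sep(x_i(t), x_j(t)))`
  has derivative `⟪∇Φ_ε(sep(x_i, x_j)), v_i - v_j⟫` at a non-coincident time `t₀`
  (`IsHamiltonianTrajectory.hasDerivAt_scaled_sepVec`): if `|sep| ≤ |ε|` at `t₀`, local linearity
  of the separation (`exists_sepVec_translate`: `sep(x + a, y + b) = sep(x, y) + (a - b)` for small
  `a, b` — on the torus, the minimal image moves rigidly with the particles) and the chain rule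
  (`Φ_ε` is differentiable off the origin, `ShortRangePotential.differentiableAt_scaled`); if
  `|sep| > |ε|` at `t₀`, continuity of `t ↦ |sep(x_i(t), x_j(t))|` makes the pair potential vanish
  identically near `t₀`, and `∇Φ_ε(sep) = 0` there as well;
* the kinetic energy has derivative `∑_i ⟪v_i, F_i⟫` (Newton's law `vel_hasDerivAt`,
  `IsHamiltonianTrajectory.hasDerivAt_configEnergy`), and
  `∑_i ⟪v_i, -∑_{j≠i} g_{ij}⟫ + ∑_{i<j} ⟪g_{ij}, v_i - v_j⟫ = 0` for any antisymmetric family `g`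
  (`sum_inner_force_add_sum_pair_eq_zero`: the summand over ordered pairs is pointwise
  antisymmetric), so `t ↦ H_N(γ t)` has zero derivative as long as `γ` avoids coincidences
  (`IsHamiltonianTrajectory.hasDerivAt_hamiltonianEnergy`) and is constant along the orbit of a
  good point (`PotentialFlow.hamiltonianEnergy_flow_eq`; `mapsTo_good`, `good_subset`,
  `is_const_of_deriv_eq_zero`, `flow_zero`);
* the flat torus is hard-sphere regular at every radius `ε < 1/2`
  (`FluidPDE.Torus.isHardSphereRegular_geometry`), whence the fact for `0 < ε < 1/2`.

## Mathlib / Literature reuse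

`HasDerivAt.norm_sq`, `Continuous.integral_hasStrictDerivAt`,
`intervalIntegral.integral_add_adjacent_intervals`, `HasFDerivAt.comp_hasDerivAt_of_eq`,
`is_const_of_deriv_eq_zero`, `Finset.sum_comm` are Mathlib's; `Geometry.IsHardSphereRegular` and
`Torus.isHardSphereRegular_geometry` are `Literature.Analysis.FluidPDE.HardSphereRegularGeometry`'s;
`ShortRangePotential.scaled_neg`, `ShortRangePotential.differentiableAt_scaled`,
`gradient_neg_eq_neg_gradient_of_even` are `PotentialDynamicsEnergyProofs`'s. No new definition,
no new named fact; no statement of `PotentialDynamics` is changed.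

## References

* I. Gallagher, L. Saint-Raymond, B. Texier, *From Newton to Boltzmann: hard spheres and
  short-range potentials*, Zurich Lectures in Advanced Mathematics, EMS (2013); arXiv:1208.5753,
  Part I Ch. 1 §2 (Newton's equations, EMS (1.2.2)), Part III Ch. 10 §2 (the `s`-particle
  Hamiltonian `E_ε`, EMS (1.2.3); conservation of energy for `𝐇_s(t)`, after Definition 2.3),
  Part III Ch. 8 §1 (conservation laws of the two-particle system). [GallagherSaintRaymondTexier2013]
-/

open MeasureTheory Metric Set Filter Topology
open scoped InnerProductSpace

noncomputable section

namespace Literature.Analysis.FunctionSpaces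

variable {d : Type*} [Fintype d]

/-! ## The rescaled potential beyond its range -/

namespace ShortRangePotential

/-- `Φ_ε` only depends on `|ε|`: it vanishes outside the ball of radius `|ε|` (`ε ≠ 0`). [folklore] -/
theorem scaled_eq_zero_of_abs_le (Φ : ShortRangePotential d) {ε : ℝ} (hε : ε ≠ 0)
    {x : EuclideanSpace ℝ d} (hx : |ε| ≤ ‖x‖) : Φ.scaled ε x = 0 := by
  refine Φ.toFun_eq_zero ?_
  rw [norm_smul, norm_inv, Real.norm_eq_abs]
  rwa [le_inv_mul_iff₀ (abs_pos.mpr hε), mul_one]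

/-- Outside the closed ball of radius `|ε|` the rescaled potential is locally zero, hence has
zero gradient there (`ε ≠ 0`). [folklore] -/
theorem hasGradientAt_scaled_zero (Φ : ShortRangePotential d) {ε : ℝ} (hε : ε ≠ 0)
    {x : EuclideanSpace ℝ d} (hx : |ε| < ‖x‖) : HasGradientAt (Φ.scaled ε) 0 x := by
  have h : Φ.scaled ε =ᶠ[𝓝 x] fun _ => 0 := by
    filter_upwards [(isOpen_lt continuous_const continuous_norm).mem_nhds hx] with y hy
    exact Φ.scaled_eq_zero_of_abs_le hε (le_of_lt hy)
  exact (hasGradientAt_const x (0 : ℝ)).congr_of_eventuallyEq h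

/-- `∇Φ_ε(x) = 0` for `|x| > |ε|` (`ε ≠ 0`; finite range). [folklore] -/
theorem gradient_scaled_eq_zero (Φ : ShortRangePotential d) {ε : ℝ} (hε : ε ≠ 0)
    {x : EuclideanSpace ℝ d} (hx : |ε| < ‖x‖) : gradient (Φ.scaled ε) x = 0 :=
  (Φ.hasGradientAt_scaled_zero hε hx).gradient

/-- The pair force is odd: `∇Φ_ε(-x) = -∇Φ_ε(x)` (action equals reaction; `Φ_ε` is even). [folklore] -/
theorem gradient_scaled_neg (Φ : ShortRangePotential d) (ε : ℝ) (x : EuclideanSpace ℝ d) :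
    gradient (Φ.scaled ε) (-x) = -gradient (Φ.scaled ε) x :=
  gradient_neg_eq_neg_gradient_of_even (Φ.scaled_neg ε) x

end ShortRangePotential

/-! ## The algebra of the cancellation -/

/-- The algebra of energy conservation: if the pair forces are odd, `g j i = -g i j` for
`i ≠ j`, then `∑_i ⟪v_i, -∑_{j ≠ i} g i j⟫ + ∑_{i<j} ⟪g i j, v_i - v_j⟫ = 0` (the power of the
internal forces cancels the time derivative of the pair energies). Both sums are double sums over
all ordered pairs of a summand `A i j` with `A i j + A j i = 0`. [folklore] -/
theorem sum_inner_force_add_sum_pair_eq_zero {N : ℕ} (g : Fin N → Fin N → EuclideanSpace ℝ d)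
    (v : Fin N → EuclideanSpace ℝ d) (hg : ∀ i j, i ≠ j → g j i = -g i j) :
    ∑ i, ⟪v i, -∑ j ∈ Finset.univ.erase i, g i j⟫_ℝ +
      ∑ i, ∑ j ∈ Finset.univ.filter (fun j => i < j), ⟪g i j, v i - v j⟫_ℝ = 0 := by
  set A : Fin N → Fin N → ℝ := fun i j =>
    (if j ≠ i then -⟪v i, g i j⟫_ℝ else 0) + (if i < j then ⟪g i j, v i - v j⟫_ℝ else 0) with hA
  have hlt : ∀ i j, i < j → A i j + A j i = 0 := by
    intro i j h
    have h1 : j ≠ i := ne_of_gt h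
    have h2 : i ≠ j := ne_of_lt h
    have h3 : ¬j < i := not_lt.2 h.le
    simp only [hA, if_pos h1, if_pos h2, if_pos h, if_neg h3, hg i j h2, inner_neg_right,
      inner_sub_right, real_inner_comm (g i j)]
    ring
  have hkey : ∀ i j, A i j + A j i = 0 := by
    intro i j
    rcases lt_trichotomy i j with h | rfl | h
    · exact hlt i j h
    · simp [hA]
    · rw [add_comm]
      exact hlt j i h
  have hL : ∑ i, ⟪v i, -∑ j ∈ Finset.univ.erase i, g i j⟫_ℝ =
      ∑ i, ∑ j, (if j ≠ i then -⟪v i, g i j⟫_ℝ else 0) := by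
    refine Finset.sum_congr rfl fun i _ => ?_
    rw [inner_neg_right, inner_sum, ← Finset.sum_neg_distrib, ← Finset.filter_ne',
      Finset.sum_filter]
  have hR : ∑ i, ∑ j ∈ Finset.univ.filter (fun j => i < j), ⟪g i j, v i - v j⟫_ℝ =
      ∑ i, ∑ j, (if i < j then ⟪g i j, v i - v j⟫_ℝ else 0) := by
    refine Finset.sum_congr rfl fun i _ => ?_
    rw [Finset.sum_filter]
  have hsum : ∑ i, ∑ j, A i j = 0 := by
    have h1 : ∑ i, ∑ j, A i j = ∑ i, ∑ j, A j i := Finset.sum_comm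
    have h2 : ∑ i, ∑ j, A i j + ∑ i, ∑ j, A j i = 0 := by
      rw [← Finset.sum_add_distrib]
      refine Finset.sum_eq_zero fun i _ => ?_
      rw [← Finset.sum_add_distrib]
      exact Finset.sum_eq_zero fun j _ => hkey i j
    linarith
  rw [hL, hR, ← Finset.sum_add_distrib]
  simp only [← Finset.sum_add_distrib]
  exact hsum

/-! ## Hamiltonian trajectories: positions and kinetic energy -/

section Trajectory

variable {X : Type*} {N : ℕ} {G : FluidPDE.Geometry d X} {Φ : ShortRangePotential d} {ε : ℝ}
  {γ : ℝ → FluidPDE.Config N d X}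

namespace IsHamiltonianTrajectory

/-- Velocities along a Hamiltonian trajectory are continuous (they are differentiable). [folklore] -/
theorem continuous_vel (hγ : IsHamiltonianTrajectory G Φ ε N γ) (i : Fin N) :
    Continuous fun s => (γ s).vel i :=
  continuous_iff_continuousAt.2 fun t => (hγ.vel_hasDerivAt t i).continuousAt

/-- Positions from any base time: `x_i(t) = x_i(t₀) + ∫_{t₀}^t v_i` (from
`x_i(t) = x_i(0) + ∫₀ᵗ v_i`, additivity of the integral and of the translation action). [folklore] -/
theorem pos_eq_translate (hγ : IsHamiltonianTrajectory G Φ ε N γ) (t₀ t : ℝ) (i : Fin N) :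
    (γ t).pos i = G.translate ((γ t₀).pos i) (∫ s in t₀..t, (γ s).vel i) := by
  have hint : ∀ a b, IntervalIntegrable (fun s => (γ s).vel i) volume a b :=
    fun a b => (hγ.continuous_vel i).intervalIntegrable a b
  rw [hγ.pos_eq t i, hγ.pos_eq t₀ i, G.translate_add,
    intervalIntegral.integral_add_adjacent_intervals (hint 0 t₀) (hint t₀ t)]

/-- The kinetic energy along a Hamiltonian trajectory: `d/dt ½∑_i |v_i|² = ∑_i ⟪v_i, F_i⟫`
(Newton's law `v̇_i = F_i`). [folklore] -/
theorem hasDerivAt_configEnergy (hγ : IsHamiltonianTrajectory G Φ ε N γ) (t : ℝ) :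
    HasDerivAt (fun s => FluidPDE.configEnergy (γ s))
      (∑ i, ⟪(γ t).vel i, force G Φ ε (γ t) i⟫_ℝ) t := by
  have h : ∀ i ∈ Finset.univ, HasDerivAt (fun s => ‖(γ s).vel i‖ ^ 2)
      (2 * ⟪(γ t).vel i, force G Φ ε (γ t) i⟫_ℝ) t :=
    fun i _ => (hγ.vel_hasDerivAt t i).norm_sq
  have h2 := (HasDerivAt.fun_sum h).const_mul (2⁻¹ : ℝ)
  have hfun : (fun s => FluidPDE.configEnergy (γ s)) =
      fun s => 2⁻¹ * ∑ i, ‖(γ s).vel i‖ ^ 2 := rfl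
  rw [hfun]
  refine h2.congr_deriv ?_
  rw [Finset.mul_sum]
  refine Finset.sum_congr rfl fun i _ => ?_
  ring

end IsHamiltonianTrajectory

/-! ## Energy conservation in a hard-sphere-regular geometry -/

section Regular

variable [TopologicalSpace X] {r : ℝ}

/-- Antisymmetry of the pair forces in a geometry which is hard-sphere regular at radius `|ε|`:
`∇Φ_ε(sep(y, x)) = -∇Φ_ε(sep(x, y))` (oddness of `sep` within the range, where `∇Φ_ε` is odd;
vanishing of `∇Φ_ε` beyond it, on both `sep(x, y)` and `sep(y, x)`). [folklore] -/
theorem gradient_scaled_sepVec_comm (hG : G.IsHardSphereRegular r) (hr : r = |ε|) (hε : ε ≠ 0)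
    (Φ : ShortRangePotential d) (x y : X) :
    gradient (Φ.scaled ε) (G.sepVec y x) = -gradient (Φ.scaled ε) (G.sepVec x y) := by
  by_cases h : ‖G.sepVec x y‖ ≤ r
  · rw [hG.sepVec_comm x y h, Φ.gradient_scaled_neg]
  · by_cases h' : ‖G.sepVec y x‖ ≤ r
    · exfalso
      rw [hG.sepVec_comm y x h', norm_neg] at h
      exact h h'
    · rw [hr, not_le] at h h'
      rw [Φ.gradient_scaled_eq_zero hε h, Φ.gradient_scaled_eq_zero hε h', neg_zero]

/-- **The pair potential along a Hamiltonian trajectory** of a geometry which is hard-sphere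
regular at radius `|ε|`, `ε ≠ 0`: at a time `t₀` where the pair `(i, j)` is not coincident,
`d/dt Φ_ε(sep(x_i(t), x_j(t)))|_{t₀} = ⟪∇Φ_ε(sep(x_i, x_j)), v_i - v_j⟫`. Within the range
(`|sep| ≤ |ε|` at `t₀`) the separation vector moves rigidly with the particles near `t₀`,
`sep(x_i(t), x_j(t)) = sep(x_i(t₀), x_j(t₀)) + (∫_{t₀}^t v_i - ∫_{t₀}^t v_j)`, and the chain rule
applies (`Φ_ε` is differentiable off the origin); beyond it the pair potential vanishes
identically near `t₀` (continuity of `t ↦ |sep(x_i(t), x_j(t))|`) and so does `∇Φ_ε(sep)`. [folklore] -/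
theorem IsHamiltonianTrajectory.hasDerivAt_scaled_sepVec (hG : G.IsHardSphereRegular r)
    (hr : r = |ε|) (hε : ε ≠ 0) (hγ : IsHamiltonianTrajectory G Φ ε N γ) (t₀ : ℝ)
    {i j : Fin N} (hij : G.sepVec ((γ t₀).pos i) ((γ t₀).pos j) ≠ 0) :
    HasDerivAt (fun t => Φ.scaled ε (G.sepVec ((γ t).pos i) ((γ t).pos j)))
      ⟪gradient (Φ.scaled ε) (G.sepVec ((γ t₀).pos i) ((γ t₀).pos j)),
        (γ t₀).vel i - (γ t₀).vel j⟫_ℝ t₀ := by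
  -- the displacements of the two particles since time `t₀`
  set a : ℝ → EuclideanSpace ℝ d := fun t => ∫ s in t₀..t, (γ s).vel i with ha
  set b : ℝ → EuclideanSpace ℝ d := fun t => ∫ s in t₀..t, (γ s).vel j with hb
  have hda : ∀ t, HasDerivAt a ((γ t).vel i) t := fun t =>
    ((hγ.continuous_vel i).integral_hasStrictDerivAt t₀ t).hasDerivAt
  have hdb : ∀ t, HasDerivAt b ((γ t).vel j) t := fun t =>
    ((hγ.continuous_vel j).integral_hasStrictDerivAt t₀ t).hasDerivAt
  have ha0 : a t₀ = 0 := intervalIntegral.integral_same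
  have hb0 : b t₀ = 0 := intervalIntegral.integral_same
  have hca : Continuous a := continuous_iff_continuousAt.2 fun t => (hda t).continuousAt
  have hcb : Continuous b := continuous_iff_continuousAt.2 fun t => (hdb t).continuousAt
  have hpos : ∀ t, G.sepVec ((γ t).pos i) ((γ t).pos j) =
      G.sepVec (G.translate ((γ t₀).pos i) (a t)) (G.translate ((γ t₀).pos j) (b t)) := by
    intro t
    rw [hγ.pos_eq_translate t₀ t i, hγ.pos_eq_translate t₀ t j]
  by_cases hle : ‖G.sepVec ((γ t₀).pos i) ((γ t₀).pos j)‖ ≤ r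
  · -- within the range: the separation vector moves rigidly with the particles near `t₀`
    obtain ⟨δ, hδ, hlin⟩ := hG.exists_sepVec_translate
    have hsmall : ∀ {c : ℝ → EuclideanSpace ℝ d}, Continuous c → c t₀ = 0 →
        ∀ᶠ t in 𝓝 t₀, ‖c t‖ < δ := by
      intro c hc hc0
      have ht : Tendsto (fun t => ‖c t‖) (𝓝 t₀) (𝓝 0) := by
        simpa [hc0] using hc.norm.tendsto t₀
      exact ht.eventually_lt_const hδ
    have hev : (fun t => Φ.scaled ε (G.sepVec ((γ t).pos i) ((γ t).pos j))) =ᶠ[𝓝 t₀]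
        fun t => Φ.scaled ε (G.sepVec ((γ t₀).pos i) ((γ t₀).pos j) + (a t - b t)) := by
      filter_upwards [hsmall hca ha0, hsmall hcb hb0] with t hat hbt
      rw [hpos t, hlin _ _ _ _ hle hat hbt]
    have h1 : HasDerivAt (fun t => G.sepVec ((γ t₀).pos i) ((γ t₀).pos j) + (a t - b t))
        ((γ t₀).vel i - (γ t₀).vel j) t₀ :=
      ((hda t₀).sub (hdb t₀)).const_add _
    have h2 : HasFDerivAt (Φ.scaled ε)
        (fderiv ℝ (Φ.scaled ε) (G.sepVec ((γ t₀).pos i) ((γ t₀).pos j)))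
        (G.sepVec ((γ t₀).pos i) ((γ t₀).pos j)) :=
      (Φ.differentiableAt_scaled ε hij).hasFDerivAt
    have h3 := h2.comp_hasDerivAt_of_eq t₀ h1 (by rw [ha0, hb0, sub_zero, add_zero])
    rw [inner_gradient_left]
    exact h3.congr_of_eventuallyEq hev
  · -- beyond the range near `t₀`: the pair potential vanishes identically there
    rw [hr, not_le] at hle
    have h1 : Continuous fun t => G.translate ((γ t₀).pos i) (a t) := by
      simpa only [Function.comp_def] using
        hG.continuous_translate.comp (continuous_const.prodMk hca)
    have h2 : Continuous fun t => G.translate ((γ t₀).pos j) (b t) := by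
      simpa only [Function.comp_def] using
        hG.continuous_translate.comp (continuous_const.prodMk hcb)
    have hcont : Continuous fun t => ‖G.sepVec ((γ t).pos i) ((γ t).pos j)‖ := by
      simp only [hpos]
      simpa only [Function.comp_def] using hG.continuous_norm_sepVec.comp (h1.prodMk h2)
    have hev : ∀ᶠ t in 𝓝 t₀, |ε| < ‖G.sepVec ((γ t).pos i) ((γ t).pos j)‖ :=
      (hcont.tendsto t₀).eventually_const_lt hle
    have hzero : (fun t => Φ.scaled ε (G.sepVec ((γ t).pos i) ((γ t).pos j))) =ᶠ[𝓝 t₀]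
        fun _ => (0 : ℝ) :=
      hev.mono fun t ht => Φ.scaled_eq_zero_of_abs_le hε ht.le
    rw [Φ.gradient_scaled_eq_zero hε hle, inner_zero_left]
    exact (hasDerivAt_const t₀ (0 : ℝ)).congr_of_eventuallyEq hzero

/-- **Conservation of energy along a Hamiltonian trajectory** of a geometry which is hard-sphere
regular at radius `|ε|`, `ε ≠ 0` (GST 2013, arXiv Part I Ch. 1 §2 and Part III Ch. 10 §2; EMS
(1.2.2)–(1.2.3)): as long as `γ` avoids coincidences,
`d/dt H_N(γ(t)) = ∑_i ⟪v_i, F_i⟫ + ∑_{i<j} ⟪∇Φ_ε(sep(x_i, x_j)), v_i - v_j⟫ = 0`, the two sums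
cancelling by antisymmetry of the pair forces (`sum_inner_force_add_sum_pair_eq_zero`). [cite: GallagherSaintRaymondTexier2013, Part I Ch. 1 §2 (Newton's equations, EMS (1.2.2)) & Part III Ch. 10 §2 (Hamiltonian E_ε, EMS (1.2.3); conservation-of-energy identities after Definition 2.3), arXiv:1208.5753 numbering] -/
theorem IsHamiltonianTrajectory.hasDerivAt_hamiltonianEnergy (hG : G.IsHardSphereRegular r)
    (hr : r = |ε|) (hε : ε ≠ 0) (hγ : IsHamiltonianTrajectory G Φ ε N γ)
    (hnc : ∀ t, γ t ∈ noCoincidence G N) (t : ℝ) :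
    HasDerivAt (fun s => hamiltonianEnergy G Φ ε (γ s)) 0 t := by
  have hK := hγ.hasDerivAt_configEnergy t
  have hV : HasDerivAt
      (fun s => ∑ i, ∑ j ∈ Finset.univ.filter (fun j => i < j),
        Φ.scaled ε (G.sepVec ((γ s).pos i) ((γ s).pos j)))
      (∑ i, ∑ j ∈ Finset.univ.filter (fun j => i < j),
        ⟪gradient (Φ.scaled ε) (G.sepVec ((γ t).pos i) ((γ t).pos j)),
          (γ t).vel i - (γ t).vel j⟫_ℝ) t := by
    refine HasDerivAt.fun_sum fun i _ => HasDerivAt.fun_sum fun j hj => ?_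
    exact hγ.hasDerivAt_scaled_sepVec hG hr hε t ((hnc t) i j (Finset.mem_filter.1 hj).2.ne)
  have hzero := sum_inner_force_add_sum_pair_eq_zero
    (fun i j => gradient (Φ.scaled ε) (G.sepVec ((γ t).pos i) ((γ t).pos j)))
    (fun i => (γ t).vel i) fun i j _ => gradient_scaled_sepVec_comm hG hr hε Φ _ _
  exact (hK.add hV).congr_deriv hzero

/-- **Conservation of energy along a potential flow** on a geometry which is hard-sphere regular
at radius `|ε|`, `ε ≠ 0`: `H_N(Ψ_t z) = H_N(z)` for every good `z` and every `t`. The orbit of a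
good point is a Hamiltonian trajectory (`isTrajectory`) staying in the good set, hence off
coincidences (`mapsTo_good`, `good_subset`), so `t ↦ H_N(Ψ_t z)` has zero derivative on `ℝ`
(`IsHamiltonianTrajectory.hasDerivAt_hamiltonianEnergy`) and is constant, and `Ψ_0 z = z`
(`flow_zero`). [cite: GallagherSaintRaymondTexier2013, Part III Ch. 10 §2 (conservation of the s-particle Hamiltonian E_ε along the flow 𝐇_s(t), after Definition 2.3) & Part I Ch. 1 §2, arXiv:1208.5753 numbering] -/
theorem PotentialFlow.hamiltonianEnergy_flow_eq [MeasureSpace X] (hG : G.IsHardSphereRegular r)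
    (hr : r = |ε|) (hε : ε ≠ 0) (Ψ : PotentialFlow G Φ ε N) {z : FluidPDE.Config N d X}
    (hz : z ∈ Ψ.good) (t : ℝ) :
    hamiltonianEnergy G Φ ε (Ψ.flow t z) = hamiltonianEnergy G Φ ε z := by
  have hd : ∀ s, HasDerivAt (fun s => hamiltonianEnergy G Φ ε (Ψ.flow s z)) 0 s := fun s =>
    (Ψ.isTrajectory z hz).hasDerivAt_hamiltonianEnergy hG hr hε
      (fun s' => Ψ.good_subset (Ψ.mapsTo_good s' hz)) s
  have h : hamiltonianEnergy G Φ ε (Ψ.flow t z) = hamiltonianEnergy G Φ ε (Ψ.flow 0 z) :=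
    is_const_of_deriv_eq_zero (fun s => (hd s).differentiableAt) (fun s => (hd s).deriv) t 0
  rwa [Ψ.flow_zero z hz] at h

end Regular

end Trajectory

/-! ## The fact -/

variable {N : ℕ} {Φ : ShortRangePotential d} {ε : ℝ}

/-- **Discharge of the named fact `hamiltonianEnergy_flow_torus`**: on the flat torus with
`0 < ε < 1/2` the Hamiltonian `H_N = ∑_i ½|v_i|² + ∑_{i<j} Φ_ε(sep(x_i, x_j))` is conserved along
every potential flow, `H_N(Ψ_t z) = H_N(z)` for good `z` (GST 2013: Newton's equations (EMS
(1.2.2), arXiv Part I Ch. 1 §2) and the Hamiltonian `E_ε` (EMS (1.2.3), arXiv Part III Ch. 10 §2),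
whose invariance under the `s`-particle flow is recorded there as
`|𝐇_s(t) g_s|_{ε,s,β} = |g_s|_{ε,s,β}`). The torus at radius `ε < 1/2` is a hard-sphere-regular
geometry (`FluidPDE.Torus.isHardSphereRegular_geometry`: the minimal image is odd and moves
rigidly with the particles on the support of `Φ_ε`), so `PotentialFlow.hamiltonianEnergy_flow_eq`
applies with `r = ε = |ε|`. [cite: GallagherSaintRaymondTexier2013, Part I Ch. 1 §2 (Newton's equations, EMS (1.2.2)) & Part III Ch. 10 §2 (Hamiltonian E_ε, EMS (1.2.3); conservation-of-energy identities after Definition 2.3); Part III Ch. 8 §1 (conservation laws), arXiv:1208.5753 numbering] -/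
theorem hamiltonianEnergy_flow_torus_holds :
    hamiltonianEnergy_flow_torus (d := d) (N := N) (Φ := Φ) (ε := ε) :=
  fun hε hε' Ψ _ hz t =>
    Ψ.hamiltonianEnergy_flow_eq (FluidPDE.Torus.isHardSphereRegular_geometry hε')
      (abs_of_pos hε).symm hε.ne' hz t

end Literature.Analysis.FunctionSpaces
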